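import Summits.ResolutionOfSingularities.ResolutionOfSingularities.Theorems.HomologicalConductorNoZenoRQuadraticTransformFibre
import Summits.ResolutionOfSingularities.ResolutionOfSingularities.Theorems.HomologicalConductorNoZenoRQuadraticTransformPointCentre
import Literature.AlgebraicGeometry.Resolution.Lipman1969H1Domination
import Literature.AlgebraicGeometry.Resolution.NormalSurfaceSingularLocus
import Literature.AlgebraicGeometry.Resolution.BlowupsComposition
import Literature.AlgebraicGeometry.Resolution.ComponentGluing
import Literature.AlgebraicGeometry.Resolution.RegularCentreBlowupSeqExtension
import HarnessLib

/-!
# Crux `NoZenoR` (stmt-ResolutionOfSingularities-19943) — Lipman's OWN proof of Theorem (4.1) for `Spec S`, assembled: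
# the minimal desingularization of a rational surface singularity EXISTS and is a blowing up of an `𝔪`-primary
# centre, MODULO the normality of the stages (Lipman Prop. (8.1))

Route `ResolutionOfSingularities/HomologicalConductor` (cell decomp-res, hand leafhand-res-homologicalconduct-21 g0).
OURS: AI-written proof over tree theorems, weaker than expert review; nothing here is a statement of the manuscript
under review (Hironaka 2017).  SUPPORT level, counted 0.  Def-free; NO named fact is assumed, but the theorems carry
the EXPLICIT HYPOTHESIS `h81` below — they are CONDITIONAL on it.

Lipman, proof of Theorem (4.1) (p. 204): "We shall assume the following result, to be proved later (Proposition (8.1)).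
*If `Y` is a normal surface having only rational singularities, and if `h : Y′ → Y` is a quadratic transformation, then
`Y′` is a normal surface.*  Now, blow up a singular point on `Y` (if there is one).  Then blow up a singular point on
the resulting surface.  Continue in this way.  The preceding result, along with 1) of Proposition (1.2), implies that
the surfaces which arise are normal and have only rational singularities. … the preceding process leads eventually to a
regular surface. … So we have a desingularization `f : X → Y`, and moreover, because of the way in which this
desingularization is obtained, (*) (§2) shows that for every desingularization `f′ : X′ → Y`, `X′` dominates `X`."

With (*) / Prop. (3.1) (`…QuadraticTransformDominated`, `…Stages`), its global form (`…GlobalStep`, `…PointCentre`) and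
termination (`…Termination`, `…Fibre`) now in the tree, this file runs the process for `Y = Spec S` by induction on
`#excCurvePoints π − #excCurvePoints(stage)` for a fixed desingularization `π` (which exists by rationality), under the
hypothesis

  `h81` : for every NORMAL stage `g : W → Spec S` (integral Noetherian, proper birational) and every closed point `w`
  with `𝒪_{W,w}` not regular, every blowing up `W₂ → W` of the point `w` has integrally closed local rings

— Lipman's Prop. (8.1) at the local rings of the stages (which have rational singularities by Prop. (1.2) 1), a tree
theorem); it is NOT proved here (complete ideals, §§5–8: XL).

* `exists_nextStage` — the inductive step with all invariants (normal stage, domination by every desingularization,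
  blow-up of `Spec S` along a centre cosupported at the closed point, curve count strictly up and `≤ #excCurvePoints π`);
* `exists_isMinimalResolution_isBlowup_of_normalStages_aux` — the induction;
* **`exists_isMinimalResolution_isBlowup_of_normalStages`** — for `S` a two-dimensional normal Noetherian local domain
  with a rational singularity, GIVEN `h81`: there is a MINIMAL desingularization `f : X₀ → Spec S` which is a blowing up
  along an ideal sheaf cosupported at the closed point — exactly the input «LMRB» of hand 16 g4's print-free door
  `Lipman41Door.Lipman1969_4_1_of_localMinimalBlowup` to the print `Lipman1969_4_1`, and the consumed form
  `exists_isMinimalResolution_Spec` of the crux chain, WITHOUT Castelnuovo's contraction theorem (27.1).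

No crux, kill test or summit statement is proved here; resolution in positive characteristic is NOT proved.

References: J. Lipman, Publ. Math. IHÉS 36 (1969), Theorem (4.1) and its proof (pp. 204–205), Prop. (8.1) (p. 212),
§2 (*) (p. 203) [`Lipman1969`].
-/

noncomputable section

-- single-problem summit: the doubled namespace component `ResolutionOfSingularities` is forced
set_option linter.dupNamespace false

open CategoryTheory CategoryTheory.Limits AlgebraicGeometry TopologicalSpace Topology IsLocalRing
open Literature.AlgebraicGeometry.Resolution

namespace Summit.ResolutionOfSingularities.ResolutionOfSingularities.Theorems.NoZeno.QuadraticTransform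

variable {S : Type} [CommRing S] [IsNoetherianRing S] [IsLocalRing S] [IsDomain S] [IsIntegrallyClosed S]

/-! ## Helpers -/

omit [IsNoetherianRing S] [IsLocalRing S] in
/-- The local rings of `Spec S`, `S` a normal domain, are integrally closed. [folklore] -/
-- adapted from the private lemma of `Literature/AlgebraicGeometry/Resolution/ResolutionWithoutExceptionalCurves`
theorem isIntegrallyClosed_stalk_Spec (y : Spec (.of S)) : IsIntegrallyClosed ((Spec (.of S)).presheaf.stalk y) := by
  letI : Algebra S ((Spec (.of S)).presheaf.stalk y) :=
    inferInstanceAs (Algebra S ((Spec.structureSheaf S).presheaf.stalk y))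
  haveI : IsLocalization.AtPrime ((Spec (.of S)).presheaf.stalk y) y.asIdeal :=
    StructureSheaf.IsLocalization.to_stalk S y
  exact isIntegrallyClosed_of_isLocalization _ y.asIdeal.primeCompl (Ideal.primeCompl_le_nonZeroDivisors _)

omit [IsNoetherianRing S] [IsDomain S] [IsIntegrallyClosed S] in
/-- A closed point of a scheme proper over `Spec` of a local ring lies over the closed point. [folklore] -/
theorem apply_eq_closedPoint_of_isClosed {W : Scheme.{0}} (g : W ⟶ Spec (.of S)) [IsProper g] {w : W}
    (hwc : IsClosed ({w} : Set W)) : g w = closedPoint S := by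
  have himg : IsClosed ({g w} : Set (Spec (.of S))) := by
    have := g.isClosedMap _ hwc
    rwa [Set.image_singleton] at this
  exact PrimeSpectrum.ext (IsLocalRing.eq_maximalIdeal ((PrimeSpectrum.isClosed_singleton_iff_isMaximal _).mp himg))

omit [IsLocalRing S] [IsDomain S] [IsIntegrallyClosed S] in
/-- On a stage (integral Noetherian, birational of finite type over the two-dimensional `S`), a point whose local ring
has dimension `2` is a closed point (`height + coheight ≤ dim W ≤ 2`, `coheight = 2`). [folklore] -/
theorem isClosed_singleton_of_ringKrullDim_stalk_eq_two (hdim : ringKrullDim S = 2) {W : Scheme.{0}} [IsIntegral W]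
    [IsNoetherian W] (g : W ⟶ Spec (.of S)) [IsProper g] (hg : IsBirational g) {w : W}
    (hw2 : ringKrullDim (W.presheaf.stalk w) = 2) : IsClosed ({w} : Set W) := by
  haveI : CompactSpace W := QuasiCompact.compactSpace_of_compactSpace g
  -- `height w = 0`
  have hdimW : topologicalKrullDim W ≤ 2 := by
    refine hg.topologicalKrullDim_le_of_isNoetherian.trans ?_
    change topologicalKrullDim (PrimeSpectrum S) ≤ 2
    rw [PrimeSpectrum.topologicalKrullDim_eq_ringKrullDim]
    exact hdim.le
  have hco : Order.coheight w = 2 := by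
    have h := ringKrullDim_stalk_eq_coheight w
    rw [hw2] at h
    have h' : ((Order.coheight w : ℕ∞) : WithBot ℕ∞) = ((2 : ℕ∞) : WithBot ℕ∞) := by
      rw [← h]; norm_cast
    exact WithBot.coe_injective h'
  have hh : Order.height w = 0 := by
    have h := (coe_height_add_coheight_le_topologicalKrullDim w).trans hdimW
    rw [hco] at h
    have h' : ((Order.height w + 2 : ℕ∞) : WithBot ℕ∞) ≤ ((2 : ℕ∞) : WithBot ℕ∞) := h.trans (by norm_cast)
    have h'' : Order.height w + 2 ≤ 0 + 2 := by
      rw [zero_add]; exact WithBot.coe_le_coe.mp h'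
    exact le_antisymm (WithTop.le_of_add_le_add_right (by decide) h'') bot_le
  -- a point of height `0` is closed: its closed specialisation is itself
  obtain ⟨c, hc, hccl⟩ := (isClosed_closure (s := ({w} : Set W))).exists_closed_singleton ⟨w, subset_closure rfl⟩
  by_cases hcw : c = w
  · rwa [hcw] at hccl
  · exfalso
    have hlt : c < w := ⟨Scheme.le_iff_specializes.2 (specializes_iff_mem_closure.mpr hc),
      fun h' => hcw ((Scheme.le_iff_specializes.1 h').antisymm (specializes_iff_mem_closure.mpr hc)).eq⟩
    have := Order.height_add_one_le hlt
    rw [hh] at this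
    exact absurd this (by simp)

/-! ## The inductive step -/

/-- **One step of Lipman's process** with all invariants.  See the module docstring.
[cite: Lipman1969, Theorem (4.1), proof (pp. 204–205)] -/
theorem exists_nextStage (hdim : ringKrullDim S = 2) (hrat : HasRationalSingularity S)
    (h81 : ∀ (W W₂ : Scheme.{0}) (_ : IsIntegral W) (_ : IsNoetherian W) (g : W ⟶ Spec (.of S)) (_ : IsProper g),
      IsBirational g → (∀ y : W, IsIntegrallyClosed (W.presheaf.stalk y)) →
      ∀ (w : W) (hwc : IsClosed ({w} : Set W)), ¬ IsRegularLocalRing (W.presheaf.stalk w) →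
      ∀ (b : W₂ ⟶ W), IsBlowup b (Scheme.IdealSheafData.vanishingIdeal ⟨{w}, hwc⟩) →
      ∀ y : W₂, IsIntegrallyClosed (W₂.presheaf.stalk y))
    {X : Scheme.{0}} (π : X ⟶ Spec (.of S)) (hπ : IsResolution π)
    {W : Scheme.{0}} [IsIntegral W] [IsNoetherian W] (g : W ⟶ Spec (.of S)) [IsProper g] (hg : IsBirational g)
    (hWn : ∀ y : W, IsIntegrallyClosed (W.presheaf.stalk y))
    (hDOM : ∀ (X' : Scheme.{0}) (ρ : X' ⟶ Spec (.of S)), IsResolution ρ → ∃ σ : X' ⟶ W, σ ≫ g = ρ ∧ IsResolution σ)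
    (hBL : ∃ J : (Spec (.of S)).IdealSheafData, IsBlowup g J ∧
      (J.support : Set (Spec (.of S))) ⊆ {closedPoint S})
    (hnreg : ¬ ∀ y : W, IsRegularLocalRing (W.presheaf.stalk y)) :
    ∃ (W₂ : Scheme.{0}) (g₂ : W₂ ⟶ Spec (.of S)), ∃ (_ : IsIntegral W₂) (_ : IsNoetherian W₂) (_ : IsProper g₂),
      IsBirational g₂ ∧ (∀ y : W₂, IsIntegrallyClosed (W₂.presheaf.stalk y)) ∧
      (∀ (X' : Scheme.{0}) (ρ : X' ⟶ Spec (.of S)), IsResolution ρ →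
        ∃ σ : X' ⟶ W₂, σ ≫ g₂ = ρ ∧ IsResolution σ) ∧
      (∃ J : (Spec (.of S)).IdealSheafData, IsBlowup g₂ J ∧ (J.support : Set (Spec (.of S))) ⊆ {closedPoint S}) ∧
      (excCurvePoints g).ncard < (excCurvePoints g₂).ncard ∧
      (excCurvePoints g₂).ncard ≤ (excCurvePoints π).ncard := by
  -- a non-regular point: normal of dimension `2`, hence closed, over the closed point
  obtain ⟨w, hwsing⟩ := not_forall.mp hnreg
  haveI := hWn w
  have hw2 : ringKrullDim (W.presheaf.stalk w) = 2 := by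
    refine le_antisymm (ringKrullDim_stalk_le_two_of_isBirational hdim.le g hg w) ?_
    by_contra hlt
    apply hwsing
    apply isRegularLocalRing_of_isIntegrallyClosed_of_ringKrullDim_le_one
    rw [ringKrullDim_stalk_eq_coheight] at hlt ⊢
    have h1 : Order.coheight w < 2 := by
      by_contra h2
      apply hlt
      have h3 : (2 : ℕ∞) ≤ Order.coheight w := not_lt.mp h2
      have h4 : ((2 : ℕ∞) : WithBot ℕ∞) ≤ ((Order.coheight w : ℕ∞) : WithBot ℕ∞) := WithBot.coe_le_coe.mpr h3
      exact le_trans (by norm_cast) h4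
    obtain ⟨m, hm⟩ := ENat.ne_top_iff_exists.mp h1.ne_top
    rw [← hm] at h1 ⊢
    have h3 : m < 2 := by exact_mod_cast h1
    have h4 : m ≤ 1 := by omega
    exact_mod_cast h4
  have hwc : IsClosed ({w} : Set W) := isClosed_singleton_of_ringKrullDim_stalk_eq_two hdim g hg hw2
  have hgw : g w = closedPoint S := apply_eq_closedPoint_of_isClosed g hwc
  -- blow up `w`
  obtain ⟨W₂, b, hb⟩ := exists_isBlowup W (Scheme.IdealSheafData.vanishingIdeal ⟨{w}, hwc⟩)
  have hI0 := vanishingIdeal_ne_bot_of_not_isRegularLocalRing hwc hwsing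
  haveI : IsProper b := hb.isProper
  haveI : IsIntegral W₂ := hb.isIntegral hI0
  haveI : IsNoetherian W₂ := by
    haveI : IsLocallyNoetherian W₂ := LocallyOfFiniteType.isLocallyNoetherian b
    haveI : CompactSpace W₂ := QuasiCompact.compactSpace_of_compactSpace (b ≫ g)
    exact {}
  have hg₂ : IsBirational (b ≫ g) := (hb.isBirational' hI0).comp hg
  have hW₂n : ∀ y : W₂, IsIntegrallyClosed (W₂.presheaf.stalk y) :=
    h81 W W₂ inferInstance inferInstance g inferInstance hg hWn w hwc hwsing b hb
  -- domination of the new stage by every desingularization (the global step (*))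
  have hDOM₂ : ∀ (X' : Scheme.{0}) (ρ : X' ⟶ Spec (.of S)), IsResolution ρ →
      ∃ σ : X' ⟶ W₂, σ ≫ (b ≫ g) = ρ ∧ IsResolution σ := by
    intro X' ρ hρ
    obtain ⟨σ', hσ', hres'⟩ := hDOM X' ρ hρ
    haveI : IsProper ρ := hρ.isProper
    haveI : IsNoetherian X' := by
      haveI : IsLocallyNoetherian X' := LocallyOfFiniteType.isLocallyNoetherian ρ
      haveI : CompactSpace X' := QuasiCompact.compactSpace_of_compactSpace ρ
      exact {}
    obtain ⟨τ, hτ, hτres⟩ :=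
      exists_isResolution_fac_pointBlowup_of_stage g σ' hdim hrat hg hres' w hwc (hWn w) hw2 hwsing hb
    exact ⟨τ, by rw [← Category.assoc, hτ, hσ'], hτres⟩
  -- the composite is a blowing up of `Spec S` along a centre cosupported at the closed point
  have hBL₂ : ∃ J : (Spec (.of S)).IdealSheafData, IsBlowup (b ≫ g) J ∧
      (J.support : Set (Spec (.of S))) ⊆ {closedPoint S} := by
    obtain ⟨J, hgJ, hJ⟩ := hBL
    obtain ⟨Q, hQ, hQsupp⟩ := IsBlowup.exists_isBlowup_comp_supported g J b
      (Scheme.IdealSheafData.vanishingIdeal ⟨{w}, hwc⟩) {closedPoint S} hgJ hJ hb (by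
        intro y hy
        rw [Scheme.IdealSheafData.coe_support_vanishingIdeal] at hy
        change y ∈ ({w} : Set W) at hy
        rw [Set.mem_singleton_iff] at hy
        subst hy
        exact hgw)
    exact ⟨Q, hQ, hQsupp⟩
  -- the count
  obtain ⟨σ₂, hσ₂fac, hσ₂⟩ := hDOM₂ X π hπ
  obtain ⟨hlt, hle⟩ := ncard_excCurvePoints_lt_of_pointBlowup_of_stage hdim π hπ g hWn hwc hgw hwsing hb σ₂ hσ₂
    (by rw [← hσ₂fac])
  exact ⟨W₂, b ≫ g, inferInstance, inferInstance, inferInstance, hg₂, hW₂n, hDOM₂, hBL₂, hlt, hle⟩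

/-! ## The induction and the theorem -/

/-- The induction on `#excCurvePoints π − #excCurvePoints(stage)`. [cite: Lipman1969, Theorem (4.1), proof (pp. 204–205)] -/
theorem exists_isMinimalResolution_isBlowup_of_normalStages_aux (hdim : ringKrullDim S = 2)
    (hrat : HasRationalSingularity S)
    (h81 : ∀ (W W₂ : Scheme.{0}) (_ : IsIntegral W) (_ : IsNoetherian W) (g : W ⟶ Spec (.of S)) (_ : IsProper g),
      IsBirational g → (∀ y : W, IsIntegrallyClosed (W.presheaf.stalk y)) →
      ∀ (w : W) (hwc : IsClosed ({w} : Set W)), ¬ IsRegularLocalRing (W.presheaf.stalk w) →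
      ∀ (b : W₂ ⟶ W), IsBlowup b (Scheme.IdealSheafData.vanishingIdeal ⟨{w}, hwc⟩) →
      ∀ y : W₂, IsIntegrallyClosed (W₂.presheaf.stalk y))
    {X : Scheme.{0}} (π : X ⟶ Spec (.of S)) (hπ : IsResolution π) :
    ∀ (k : ℕ) (W : Scheme.{0}) (g : W ⟶ Spec (.of S)) (_ : IsIntegral W) (_ : IsNoetherian W) (_ : IsProper g),
      IsBirational g → (∀ y : W, IsIntegrallyClosed (W.presheaf.stalk y)) →
      (∀ (X' : Scheme.{0}) (ρ : X' ⟶ Spec (.of S)), IsResolution ρ → ∃ σ : X' ⟶ W, σ ≫ g = ρ ∧ IsResolution σ) →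
      (∃ J : (Spec (.of S)).IdealSheafData, IsBlowup g J ∧ (J.support : Set (Spec (.of S))) ⊆ {closedPoint S}) →
      (excCurvePoints π).ncard ≤ (excCurvePoints g).ncard + k →
      ∃ (X₀ : Scheme.{0}) (f : X₀ ⟶ Spec (.of S)) (J : (Spec (.of S)).IdealSheafData),
        IsMinimalResolution f ∧ IsBlowup f J ∧ (J.support : Set (Spec (.of S))) ⊆ {closedPoint S} := by
  intro k
  induction k with
  | zero =>
    intro W g _ _ _ hg hWn hDOM hBL hgap
    by_cases hreg : ∀ y : W, IsRegularLocalRing (W.presheaf.stalk y)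
    · obtain ⟨J, hgJ, hJ⟩ := hBL
      exact ⟨W, g, J, ⟨⟨inferInstance, hg, hreg⟩, fun X' ρ hρ => (hDOM X' ρ hρ).imp fun σ h => h.1⟩, hgJ, hJ⟩
    · obtain ⟨W₂, g₂, _, _, _, -, -, -, -, hlt, hle⟩ :=
        exists_nextStage hdim hrat h81 π hπ g hg hWn hDOM hBL hreg
      exfalso
      rw [Nat.add_zero] at hgap
      exact absurd (hle.trans hgap) (not_le.mpr hlt)
  | succ k ih =>
    intro W g _ _ _ hg hWn hDOM hBL hgap
    by_cases hreg : ∀ y : W, IsRegularLocalRing (W.presheaf.stalk y)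
    · obtain ⟨J, hgJ, hJ⟩ := hBL
      exact ⟨W, g, J, ⟨⟨inferInstance, hg, hreg⟩, fun X' ρ hρ => (hDOM X' ρ hρ).imp fun σ h => h.1⟩, hgJ, hJ⟩
    · obtain ⟨W₂, g₂, _, _, _, hg₂, hW₂n, hDOM₂, hBL₂, hlt, hle⟩ :=
        exists_nextStage hdim hrat h81 π hπ g hg hWn hDOM hBL hreg
      exact ih W₂ g₂ inferInstance inferInstance inferInstance hg₂ hW₂n hDOM₂ hBL₂ (by omega)

/-- **Lipman's Theorem (4.1) for `Spec S`, by Lipman's own proof, modulo the normality of the stages (Prop. (8.1)).**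
For `S` a two-dimensional normal Noetherian local domain with a rational singularity, IF every blowing up of a normal
stage of `Spec S` at a non-regular closed point has integrally closed local rings (`h81`), then `Spec S` has a MINIMAL
desingularization `f : X₀ → Spec S` (every desingularization factors through `f`), and `f` is a blowing up along an
ideal sheaf cosupported at the closed point.  No contraction theorem (27.1) is used.
[cite: Lipman1969, Theorem (4.1) and its proof (pp. 204–205), Proposition (8.1) (p. 212)] -/
theorem exists_isMinimalResolution_isBlowup_of_normalStages (hdim : ringKrullDim S = 2)
    (hrat : HasRationalSingularity S)
    (h81 : ∀ (W W₂ : Scheme.{0}) (_ : IsIntegral W) (_ : IsNoetherian W) (g : W ⟶ Spec (.of S)) (_ : IsProper g),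
      IsBirational g → (∀ y : W, IsIntegrallyClosed (W.presheaf.stalk y)) →
      ∀ (w : W) (hwc : IsClosed ({w} : Set W)), ¬ IsRegularLocalRing (W.presheaf.stalk w) →
      ∀ (b : W₂ ⟶ W), IsBlowup b (Scheme.IdealSheafData.vanishingIdeal ⟨{w}, hwc⟩) →
      ∀ y : W₂, IsIntegrallyClosed (W₂.presheaf.stalk y)) :
    ∃ (X₀ : Scheme.{0}) (f : X₀ ⟶ Spec (.of S)) (J : (Spec (.of S)).IdealSheafData),
      IsMinimalResolution f ∧ IsBlowup f J ∧ (J.support : Set (Spec (.of S))) ⊆ {closedPoint S} := by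
  have hrat' := hrat
  obtain ⟨X, π, hπ, -⟩ := hrat'
  refine exists_isMinimalResolution_isBlowup_of_normalStages_aux hdim hrat h81 π hπ (excCurvePoints π).ncard
    (Spec (.of S)) (𝟙 _) inferInstance inferInstance inferInstance (isBirational_id _) isIntegrallyClosed_stalk_Spec
    (fun X' ρ hρ => ⟨ρ, Category.comp_id ρ, hρ⟩) ⟨⊤, isBlowup_id_top _, by simp⟩ ?_
  exact le_add_self

end Summit.ResolutionOfSingularities.ResolutionOfSingularities.Theorems.NoZeno.QuadraticTransform

end
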